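import Summits.RiemannHypothesis.RiemannHypothesis.Theorems.PfPersistenceSectorLocality
import Summits.RiemannHypothesis.RiemannHypothesis.Theorems.PfPersistenceDialSpaceLeaf
import Summits.RiemannHypothesis.RiemannHypothesis.Theorems.PfPersistenceGalerkinDownCone
import HarnessLib

/-!
# PF persistence — DIAL MATCHING for criteria that read finitely many numbers (pub-rhpf, barrier-typer gen 3)

**HONEST FRAMING. This is a long-odds MECHANISM SEARCH; no RH claims.** Every statement below is RH-free
bookkeeping about the cell's observatory records; nothing here bears on the truth of RH.

RULING A42 (adj-3 gen 6) RETURNED the "multi-dial matching" closure argument for magnitude / ratio readers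
(`L_k × R1 ∩ G1.22`: a criterion reads `k` real numbers `F d : Fin k → ℝ` off the data and accepts `ζ` with a margin)
as a dimension count, not a theorem, and asked the barrier-typer to TYPE the lemma shape with its hypotheses EXPLICIT.
This file does that, and proves the two cases that ARE theorems:

* §1 READERS. `FactorsThrough S F` (membership depends on `d` only through `F d`); the margin class
  `marginClass F η = {d | ∀ i, |F d i − F ζ i| < η}`; `ReaderContinuousAt F d₀` (the `k` numbers are continuous at `d₀`
  in the window-uniform form topology `UniformlyClose` — the `R1`-with-an-`a`-uniform-modulus hypothesis, EXPLICIT).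
* §2 TOLERANCE MATCHING IS WALL W2 (PROVED, one dial suffices): a continuous reader is matched to ANY tolerance `η` by
  ONE small prime dial of `ζ` that is form-negative at some window — modulo the TYPED accumulation input
  `DialReady p β₀` only (`toleranceMatching_one_dial`); hence a class containing a margin class of a continuous reader is
  uniformly robust at `ζ` and cannot separate (`not_separates_of_marginClass_subset`). No Jacobian is needed here.
* §3 EXACT MATCHING. `multiDial L w` (finitely many prime dials composed); the RETURNED conclusion as a TYPED
  hypothesis `ExactMultiDialMatching F` (some composite of prime dials of `ζ`, `≠ ζ`, has the SAME `k` readings as `ζ`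
  and is detectably negative) — per instance this is DATA (a certified fake, A11) or an implicit-function argument whose
  rank hypothesis (A42 (i)–(ii)) is NOT exhibited and NOT typed here; `FactorsThrough.not_separates` (PROVED) turns it
  into non-separation; and for readers of BOUNDED HEIGHT (`F d` depends only on the windows of height `≤ A`) exact
  matching is PROVED outright by ONE heavy prime dial (`exactMultiDialMatching_of_determinedBelow`, from
  `exists_heavyDial_mem_negative_of_determinedOn_below`).

All witnesses are prime dials of `ζ` (arithmetic tables); the `arithDialSpace` packaging follows in the height-locality
file once `PfPersistenceArithDialSpace` is in the tree.
-/

set_option linter.dupNamespace false  -- the mandated namespace repeats `RiemannHypothesis`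

noncomputable section

open Real Finset Matrix

namespace Summit.RiemannHypothesis.RiemannHypothesis.Theorems.PfPersistence

/-! ## §1 Readers -/

/-- `S` FACTORS THROUGH the reader `F`: membership depends on the datum only through the read value `F d`. [folklore] -/
def FactorsThrough {ρ : Type} (S : Set Datum) (F : Datum → ρ) : Prop :=
  ∀ d d' : Datum, F d = F d' → (d ∈ S ↔ d' ∈ S)

/-- the MARGIN CLASS of a `k`-number reader at tolerance `η`: data whose `k` readings are within `η` of `ζ`'s. [folklore] -/
def marginClass {k : ℕ} (F : Datum → Fin k → ℝ) (η : ℝ) : Set Datum :=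
  {d | ∀ i, |F d i - F zetaDatum i| < η}

/-- PROVED: `ζ` is in every margin class of positive tolerance. [folklore] -/
theorem zetaDatum_mem_marginClass {k : ℕ} (F : Datum → Fin k → ℝ) {η : ℝ} (hη : 0 < η) :
    zetaDatum ∈ marginClass F η := fun i => by simpa using hη

/-- the reader's `k` numbers are CONTINUOUS AT `d₀` in the window-uniform form topology: every tolerance `η` is met by
all data uniformly `ε`-close to `d₀`, for some `ε > 0` (EXPLICIT hypothesis: an `R1` functional with an `a`-uniform
modulus of continuity; e.g. bottom eigenvalues, NOT eigenvalue ratios at a near-degenerate cluster). [folklore] -/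
def ReaderContinuousAt {k : ℕ} (F : Datum → Fin k → ℝ) (d₀ : Datum) : Prop :=
  ∀ η : ℝ, 0 < η → ∃ ε : ℝ, 0 < ε ∧ ∀ d : Datum, UniformlyClose ε d₀ d → ∀ i, |F d i - F d₀ i| < η

/-- PROVED: a class containing a margin class of a reader continuous at `ζ` is uniformly robust at `ζ` (wall W2's
hypothesis). [folklore] -/
theorem uniformlyRobustAt_of_marginClass_subset {k : ℕ} {F : Datum → Fin k → ℝ} (hF : ReaderContinuousAt F zetaDatum)
    {η : ℝ} (hη : 0 < η) {S : Set Datum} (hS : marginClass F η ⊆ S) : UniformlyRobustAt S zetaDatum := by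
  obtain ⟨ε, hε, h⟩ := hF η hη
  exact ⟨ε, hε, fun d hd => hS (h d hd)⟩

/-! ## §2 Tolerance matching is wall W2 — one dial suffices -/

/-- **PROVED — TOLERANCE MATCHING BY ONE PRIME DIAL (modulo `DialReady`).** For a reader continuous at `ζ` and any
tolerance `η > 0`: if the prime power `p` (weight `> 0`) is dial-ready with pattern margin `β₀ > 0`, then some dial
`K ≠ 1` at `p` gives a datum `≠ ζ` whose `k` readings are ALL within `η` of `ζ`'s and which is form-NEGATIVE at a
window. No Jacobian / rank hypothesis is involved. [folklore] -/
theorem toleranceMatching_one_dial {k : ℕ} {F : Datum → Fin k → ℝ} (hF : ReaderContinuousAt F zetaDatum)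
    {η : ℝ} (hη : 0 < η) {p : ℕ} {β₀ : ℝ} (hβ₀ : 0 < β₀) (hw : 0 < zetaWeights p) (hready : DialReady p β₀) :
    ∃ (K : ℝ) (win : Window) (v : Fin (win.N + 1) → ℝ), K ≠ 1 ∧ datumOf (dial p K zetaWeights) ≠ zetaDatum ∧
      (∀ i, |F (datumOf (dial p K zetaWeights)) i - F zetaDatum i| < η) ∧
      v ⬝ᵥ (evenBlock (dial p K zetaWeights) win *ᵥ v) < 0 := by
  obtain ⟨ε, hε, h⟩ := hF η hη
  obtain ⟨K, win, v, hK, hne, -, hneg, hclose⟩ := exists_negative_dial_uniformlyClose_ne hβ₀ hw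
    (fun win hp v => primePattern_form_abs_le win.ha hp v) hready hε
  exact ⟨K, win, v, hK, hne, h _ hclose, hneg⟩

/-- PROVED: the matched dial lies in the margin class and is detectably negative. [folklore] -/
theorem marginClass_meets_dialNegativesNe {k : ℕ} {F : Datum → Fin k → ℝ} (hF : ReaderContinuousAt F zetaDatum)
    {η : ℝ} (hη : 0 < η) {p : ℕ} {β₀ : ℝ} (hβ₀ : 0 < β₀) (hw : 0 < zetaWeights p) (hready : DialReady p β₀) :
    ∃ K : ℝ, datumOf (dial p K zetaWeights) ≠ zetaDatum ∧ datumOf (dial p K zetaWeights) ∈ marginClass F η ∧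
      DetectablyNegative (datumOf (dial p K zetaWeights)) := by
  obtain ⟨K, win, v, -, hne, hmatch, hneg⟩ := toleranceMatching_one_dial hF hη hβ₀ hw hready
  exact ⟨K, hne, hmatch, win, v, hneg⟩

/-- **PROVED (wall W2 for margin readers):** a class containing a margin class of a reader continuous at `ζ` cannot
separate `ζ` from the detectably negative dial data (domain `⊇ dialSpace`), modulo `DialReady p β₀` at one weighted
prime power. [folklore] -/
theorem not_separates_of_marginClass_subset {k : ℕ} {F : Datum → Fin k → ℝ} (hF : ReaderContinuousAt F zetaDatum)
    {η : ℝ} (hη : 0 < η) {S D : Set Datum} (hS : marginClass F η ⊆ S) (hD : dialSpace ⊆ D)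
    {p : ℕ} {β₀ : ℝ} (hβ₀ : 0 < β₀) (hw : 0 < zetaWeights p) (hready : DialReady p β₀) :
    ¬ Separates S D zetaDatum :=
  not_separates_of_uniformlyRobust
    (negativesAccumulateNe_dialSpace_of_dialReady hβ₀ hw (fun win hp v => primePattern_form_abs_le win.ha hp v)
      hready).negativesAccumulate hD (uniformlyRobustAt_of_marginClass_subset hF hη hS)

/-! ## §3 Exact matching: the typed hypothesis, its use, and the height-bounded case -/

/-- finitely many dials composed: `multiDial [(p₁, K₁), …, (p_r, K_r)] w = dial p₁ K₁ (⋯ (dial p_r K_r w))`. [folklore] -/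
def multiDial : List (ℕ × ℝ) → Weights → Weights
  | [], w => w
  | (p, K) :: L, w => dial p K (multiDial L w)

/-- PROVED: one dial. [folklore] -/
@[simp] theorem multiDial_singleton (p : ℕ) (K : ℝ) (w : Weights) : multiDial [(p, K)] w = dial p K w := rfl

/-- PROVED: multi-dial data are dial-space data. [folklore] -/
theorem datumOf_multiDial_mem_dialSpace (L : List (ℕ × ℝ)) (w : Weights) : datumOf (multiDial L w) ∈ dialSpace :=
  ⟨_, rfl⟩

/-- **TYPED — EXACT MULTI-DIAL MATCHING for the reader `F` (the conclusion RULING A42 returned):** some composite of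
PRIME dials of `ζ`, distinct from `ζ` as a datum, has EXACTLY `ζ`'s readings and is detectably negative. For a reader
of all heights this is NOT proved here: per instance it is DATA (a certified fake) or an implicit-function argument
needing (i) differentiable dependence of `F` on the dials and (ii) a rank statement for the Jacobian — neither is
exhibited (A42). Rows use it only as an explicit hypothesis. [folklore] -/
def ExactMultiDialMatching {ρ : Type} (F : Datum → ρ) : Prop :=
  ∃ L : List (ℕ × ℝ), (∀ pk ∈ L, pk.1.Prime) ∧ datumOf (multiDial L zetaWeights) ≠ zetaDatum ∧
    F (datumOf (multiDial L zetaWeights)) = F zetaDatum ∧ DetectablyNegative (datumOf (multiDial L zetaWeights))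

/-- **PROVED (use of the hypothesis):** a class factoring through `F` cannot separate `ζ` from the detectably negative
dial data once `F` is exactly matched. [folklore] -/
theorem FactorsThrough.not_separates {ρ : Type} {S : Set Datum} {F : Datum → ρ} (hF : FactorsThrough S F)
    (hM : ExactMultiDialMatching F) {D : Set Datum} (hD : dialSpace ⊆ D) : ¬ Separates S D zetaDatum := by
  rintro ⟨hζ, hsep⟩
  obtain ⟨L, -, -, hFeq, hneg⟩ := hM
  exact hsep _ (hD (datumOf_multiDial_mem_dialSpace L zetaWeights)) hneg ((hF _ _ hFeq).2 hζ)

/-- **PROVED — EXACT MATCHING AT BOUNDED HEIGHT, one heavy dial:** if the reader depends on the datum only through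
the windows of height `≤ A` (any number of read values, any codomain), then ONE heavy prime dial `p > e^{2A}` matches
`ζ`'s readings EXACTLY and is form-negative at `(log p, 0)`. This is the theorem the dimension count gestures at in
the only regime where it is one; no rank hypothesis. [folklore] -/
theorem exactMultiDialMatching_of_determinedBelow {ρ : Type} {F : Datum → ρ} {A : ℝ}
    (hF : ∀ d d' : Datum, (∀ win ∈ below A, d win = d' win) → F d = F d') : ExactMultiDialMatching F := by
  have hS : DeterminedOn {d | F d = F zetaDatum} (below A) := fun d d' h => by
    simp only [Set.mem_setOf_eq, hF d d' h]
  obtain ⟨p, hp, K, hK, hmem, v, hv⟩ :=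
    exists_heavyDial_mem_negative_of_determinedOn_below hS (by simp only [Set.mem_setOf_eq])
  refine ⟨[(p, K)], by simp [hp], ?_, ?_, logWindow p hp.two_le, v, ?_⟩
  · show datumOf (dial p K zetaWeights) ≠ zetaDatum
    exact datumOf_dial_ne hp.two_le hK.ne' (zetaWeights_pos_of_prime hp).ne'
  · show F (datumOf (dial p K zetaWeights)) = F zetaDatum
    exact hmem
  · show v ⬝ᵥ (datumOf (dial p K zetaWeights) (logWindow p hp.two_le) *ᵥ v) < 0
    exact hv

/-- PROVED (corollary): a class factoring through a bounded-height reader cannot separate — wall W1 at bounded height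
in reader form (cf. `not_separates_of_determinedOn_below`). [folklore] -/
theorem FactorsThrough.not_separates_of_determinedBelow {ρ : Type} {S : Set Datum} {F : Datum → ρ} {A : ℝ}
    (hS : FactorsThrough S F) (hF : ∀ d d' : Datum, (∀ win ∈ below A, d win = d' win) → F d = F d')
    {D : Set Datum} (hD : dialSpace ⊆ D) : ¬ Separates S D zetaDatum :=
  hS.not_separates (exactMultiDialMatching_of_determinedBelow hF) hD

end Summit.RiemannHypothesis.RiemannHypothesis.Theorems.PfPersistence

end
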